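import Mathlib
import Literature.Computability.AlgebraicComplexity.GenericTorusGrading

/-!
# Crux `FreeSubtorus.OrbitDimensionBound` (stmt-ValiantsHypothesis-16133), line `Sketch` —
# stub `stub_degMap`: the degree map of ONE generic torus element, additive modulo `ker b`

Setting: an injective family of primes `p : Fin s → ℕ` and an integer matrix `b : Fin s → ι → ℤ`.
Write `B w = (∑_k b_{jk} w_k)_j : ℤ^ι → ℤ^s` and `χ w = ∏_j p_j ^ (B w)_j = tpow p (B w)` (tree
`TorusGrading.tpow`): these are the character values of the generic element `t₀` of the subtorus on
the weights `w ∈ ℤ^ι`.  Conclusion: there is a DEGREE MAP `Deg : ℂ → ℤ^ι` with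
`Deg (z · χ w) = Deg z + w + y`, `B y = 0`, for every `z ≠ 0` and every weight `w`.

Proof (the tree's `TorusGrading.deg_mul_tpow` is the case `b = id`).  First an abstract statement
for ANY multiplicative nonvanishing `χ : ℤ^ι → ℂ` (`exists_degMap_of_character`): partition `ℂ` into
the classes `z ~ z' ⇔ z = z' · χ w` for some `w ∈ ℤ^ι` (an equivalence relation), choose ONE
representative `rep z` per class (`Classical.epsilon` of the class, which depends only on the class)
and let `Deg z` be a chosen exponent with `z = rep z · χ (Deg z)` (`choose`).  For `z ≠ 0` the numbers
`z` and `z · χ w` have the same representative `r ≠ 0`, so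
`r · χ (Deg (z χ w)) = z · χ w = r · χ (Deg z) · χ w = r · χ (Deg z + w)`; cancelling `r` gives
`χ (Deg (z χ w)) = χ (Deg z + w)`.  For `χ = tpow p ∘ B` (multiplicative by additivity of `B` and
`tpow_add`, nonvanishing by `tpow_ne_zero`) the tree's `tpow_injective` (unique factorisation) turns
this into `B (Deg (z χ w)) = B (Deg z + w)`, i.e. the claim with `y := Deg (z χ w) - Deg z - w`.
[folklore]

Helper file for the crux (`--supports`); it closes nothing by itself.  Deliberately NOT here: the
other calibration stubs of the line (`stub_perpBasis`, `stub_eigenGauge`, `stub_saturationBasis`)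
and the open `stub_smallFace`.
-/

-- Sub = Summit single-conjunct layout: the duplicated namespace component is mandated by the tree.
set_option linter.dupNamespace false

noncomputable section

namespace Summit.ValiantsHypothesis.ValiantsHypothesis.Theorems.FreeSubtorusOrbitDimensionBound

open Finset
open Literature.Computability.AlgebraicComplexity.TorusGrading

/-- **Degree map of a character, abstract form.**  For a multiplicative nonvanishing
`χ : ℤ^ι → ℂ` there is `Deg : ℂ → ℤ^ι` with `χ (Deg (z · χ w)) = χ (Deg z + w)` for all `z ≠ 0` and
all `w` (classes of `ℂ` modulo `χ(ℤ^ι)`, one `Classical.epsilon`-chosen representative per class,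
`Deg z` a chosen exponent with `z = rep z · χ (Deg z)`; cancel the common nonzero representative of
`z` and `z · χ w`). [folklore] -/
theorem exists_degMap_of_character {ι : Type} (χ : (ι → ℤ) → ℂ)
    (hadd : ∀ w w', χ (w + w') = χ w * χ w') (hne : ∀ w, χ w ≠ 0) :
    ∃ Deg : ℂ → ι → ℤ, ∀ z : ℂ, z ≠ 0 → ∀ w : ι → ℤ, χ (Deg (z * χ w)) = χ (Deg z + w) := by
  -- `χ 0 = 1` and `χ (-w) = (χ w)⁻¹`
  have h0 : χ 0 = 1 := mul_left_cancel₀ (hne 0) (by rw [← hadd, add_zero, mul_one])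
  have hneg : ∀ w, χ (-w) = (χ w)⁻¹ := fun w =>
    eq_inv_of_mul_eq_one_left (by rw [← hadd, neg_add_cancel, h0])
  -- the classes of `ℂ` modulo `χ(ℤ^ι)`: `z' ∈ cl z ⇔ z = z' · χ w` for some `w`
  obtain ⟨cl, hcl⟩ : ∃ cl : ℂ → Set ℂ, ∀ z z', z' ∈ cl z ↔ ∃ w, z = z' * χ w :=
    ⟨fun z => {z' | ∃ w, z = z' * χ w}, fun _ _ => Iff.rfl⟩
  have cl_self : ∀ z, z ∈ cl z := fun z => (hcl z z).2 ⟨0, by rw [h0, mul_one]⟩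
  have cl_symm : ∀ {z z'}, z' ∈ cl z → z ∈ cl z' := by
    intro z z' h
    obtain ⟨w, rfl⟩ := (hcl _ _).1 h
    exact (hcl _ _).2 ⟨-w, by rw [hneg, mul_assoc, mul_inv_cancel₀ (hne w), mul_one]⟩
  have cl_trans : ∀ {z z' z''}, z' ∈ cl z → z'' ∈ cl z' → z'' ∈ cl z := by
    intro z z' z'' h h'
    obtain ⟨w, rfl⟩ := (hcl _ _).1 h
    obtain ⟨w', rfl⟩ := (hcl _ _).1 h'
    exact (hcl _ _).2 ⟨w' + w, by rw [hadd, mul_assoc]⟩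
  have cl_eq : ∀ {z z'}, z' ∈ cl z → cl z = cl z' := by
    intro z z' h
    ext z''
    exact ⟨fun hz => cl_trans (cl_symm h) hz, fun hz => cl_trans h hz⟩
  -- ONE representative per class
  obtain ⟨rep, rep_mem, rep_eq⟩ :
      ∃ rep : ℂ → ℂ, (∀ z, rep z ∈ cl z) ∧ ∀ z z', z' ∈ cl z → rep z = rep z' := by
    refine ⟨fun z => Classical.epsilon fun z' => z' ∈ cl z,
      fun z => Classical.epsilon_spec (p := fun z' => z' ∈ cl z) ⟨z, cl_self z⟩, fun z z' h => ?_⟩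
    show Classical.epsilon (fun z'' => z'' ∈ cl z) = Classical.epsilon (fun z'' => z'' ∈ cl z')
    rw [cl_eq h]
  -- the degree: a chosen exponent with `z = rep z · χ (Deg z)`
  have rep_spec : ∀ z, ∃ w : ι → ℤ, z = rep z * χ w := fun z => (hcl _ _).1 (rep_mem z)
  choose Deg hDeg using rep_spec
  refine ⟨Deg, fun z hz w => ?_⟩
  -- `z` and `z · χ w` have the same representative `r ≠ 0`; cancel it
  have hrep : rep (z * χ w) = rep z := rep_eq _ _ ((hcl _ _).2 ⟨w, rfl⟩)
  have h1 := hDeg (z * χ w)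
  have h2 := hDeg z
  rw [hrep] at h1
  have hr : rep z ≠ 0 := by intro hr0; rw [hr0, zero_mul] at h2; exact hz h2
  apply mul_left_cancel₀ hr
  rw [← h1, hadd, ← mul_assoc, ← h2]

/-- **Registered stub S3 (`stub_degMap`; unique factorisation).**  For an injective family of primes
`p j` and an integer matrix `b`, write `χ w = ∏_j p_j ^ ⟨b j, w⟩` (tree `TorusGrading.tpow`); there is
a degree map `Deg : ℂ → ℤ^ι` with `Deg (z · χ w) = Deg z + w` MODULO `ker b` for `z ≠ 0` (classes of
`ℂ` modulo the subgroup `χ(ℤ^ι)`, a chosen representative per class, `tpow_injective`; the case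
`b = id` is the tree's `TorusGrading.deg_mul_tpow`). [folklore] -/
theorem stub_degMap {ι : Type} [Fintype ι] [DecidableEq ι] (s : ℕ) (p : Fin s → ℕ)
    (hp : ∀ j, (p j).Prime) (hinj : Function.Injective p) (b : Fin s → ι → ℤ) :
    ∃ Deg : ℂ → ι → ℤ, ∀ z : ℂ, z ≠ 0 → ∀ w : ι → ℤ,
      ∃ y : ι → ℤ, (∀ j, ∑ k, b j k * y k = 0) ∧
        Deg (z * Literature.Computability.AlgebraicComplexity.TorusGrading.tpow p
          (fun j => ∑ k, b j k * w k)) = Deg z + w + y := by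
  have hp0 : ∀ j, p j ≠ 0 := fun j => (hp j).ne_zero
  -- the character `χ w = tpow p (B w)` is multiplicative (additivity of `B`, `tpow_add`) and nonzero
  obtain ⟨Deg, hDeg⟩ := exists_degMap_of_character (fun w : ι → ℤ => tpow p fun j => ∑ k, b j k * w k)
    (fun w w' => by
      show tpow p (fun j => ∑ k, b j k * (w + w') k) =
        tpow p (fun j => ∑ k, b j k * w k) * tpow p (fun j => ∑ k, b j k * w' k)
      rw [← tpow_add hp0]
      congr 1
      funext j
      simp only [Pi.add_apply, mul_add, sum_add_distrib])
    (fun w => tpow_ne_zero hp0 _)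
  refine ⟨Deg, fun z hz w => ?_⟩
  -- unique factorisation: `B (Deg (z χ w)) = B (Deg z + w)`
  have key : (fun j => ∑ k, b j k * Deg (z * tpow p fun j => ∑ k, b j k * w k) k) =
      fun j => ∑ k, b j k * (Deg z + w) k :=
    tpow_injective hp hinj (hDeg z hz w)
  refine ⟨Deg (z * tpow p fun j => ∑ k, b j k * w k) - Deg z - w, fun j => ?_, by abel⟩
  have hj := congr_fun key j
  simp only [Pi.add_apply, mul_add, sum_add_distrib] at hj
  simp only [Pi.sub_apply, mul_sub, sum_sub_distrib]
  rw [hj]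
  abel

end Summit.ValiantsHypothesis.ValiantsHypothesis.Theorems.FreeSubtorusOrbitDimensionBound
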